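import Summits.PneNP.PneNP.Theorems.ChebyshevTracialDesignTiltedJunta
import Summits.PneNP.PneNP.Theorems.ChebyshevTracialDesignTiltedJuntaClassSplit
import HarnessLib

/-!
# Cell pnp-psdrank, route `ChebyshevTracialDesign`: TILTED JUNTAS ON A SMALL BLOCK WITH INTERNAL EDGES, PER MATCHING, every outer-constant
# direction (brick J4b = 163b; crux `TracialDecayExp20`, stmt-PneNP-19878)

Brick 163b (prover g31; MEMO-34 §6). **`juntaHH_tilted_designValue_le`**: exact design `(n,t,T,D,B_v,C,w)`, a perfect matching `M` (`n = 2N`), a block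
`H` with `a` internal and `b` crossing `M`-edges, `t = 2s₀+1`, `a + 2 + D′ = D`, `a ≤ T`, `R` admissible (`R + 3(D′+1) + b + a + (T−1)/2 ≤ s₀`,
`… + s₀ + 2 ≤ N`, `(b/R)²e^{3b/R} ≤ 2`), a junta mask `0 ≤ f ≤ G` of the in-set and a direction `|v| ≤ 1` CONSTANT (`u₀`) on the edges outside `H`
(arbitrary on the `a + b` edges meeting `H`):
`|PM|·Σ_U W(U,M)·f(U∩H)·(Σ_p v_p x_p x_{πp})² ≤ B_v·C((T−1)/2, D′+1)·3^a·G·(4b+t+5T+4)²·(¼(b/R)²e^{3b/R})^{D′+1}`.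
Proof: brick 159a's averaged class split along `K = V(AA(H))`; per representative pattern `A` the reduced object is brick 162c's with the junta
`J ↦ f((A∩H) ∪ J)`, `α_h = v_h + v_{πh} − 2u₀`, `κ = u₀`, `|L_A| ≤ t` (163a `containment_union_pattern_J`); `Σ_{f,g} C(a,f)C(a−f,g) = 3^a`.
WHAT THIS FILE DOES NOT DO: the average over matchings (163c) and the rungs (163d).
[cite: Rothvoss2017, §2 (PDF p. 6)] [cite: Agarwal2000DifferenceEquations, Remark 1.8.1 (1.8.8)] [cite: ChattamvelliShanmugam2020, §7.4]
Stature: support/instrument (kernel lane, no defs, axioms standard). WHAT THIS IS NOT: nothing on spread / non-junta masks (the open heart, N2), no proof or refutation of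
`TracialDecayExp20`, nothing on psd rank of P_PM(K_n), no P-vs-NP content. Supports stmt-PneNP-19878.
-/

set_option linter.dupNamespace false -- `Summit.PneNP.PneNP.…`: summit = sub-problem (D-0017)

noncomputable section

namespace Summit.PneNP.PneNP.Theorems.ChebyshevTracialDesignTiltedJuntaClasses

open Finset Polynomial Literature.Barriers.PneNP Literature.Combinatorics.Optimization
open Literature.Combinatorics.Optimization.ShellStep
open Summit.PneNP.PneNP.Theorems.ChebyshevTracialDesignShellOperatorForm (designValue_eq_shellAvg)
open Summit.PneNP.PneNP.Theorems.ChebyshevTracialDesignSmallBlockClassWeights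
open Summit.PneNP.PneNP.Theorems.ChebyshevTracialDesignSmallBlockMaskPricingHH (sdiff_vAA_facts)
open Summit.PneNP.PneNP.Theorems.ChebyshevTracialDesignTiltedJunta (tiltedJunta_levelSum_le)
open Summit.PneNP.PneNP.Theorems.ChebyshevTracialDesignTwoBlockClassSplit (shellAvg_eq_sum_classWeight_mul_avg₂)

open Summit.PneNP.PneNP.Theorems.ChebyshevTracialDesignTiltedJuntaClassSplit

variable {n : ℕ}

/-! ### §2 The per-matching pricing for junta masks on blocks WITH internal edges -/

section Main

/-- **TILTED JUNTAS ON A SMALL BLOCK WITH INTERNAL EDGES, PER MATCHING, EVERY OUTER-CONSTANT DIRECTION (brick J4).** For an exact design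
`(n,t,T,D,B_v,C,w)`, a perfect matching `M` of `[n]` (`n = 2N`), a block `H` with `a` internal and `b` crossing `M`-edges, `t = 2s₀+1`,
`a + 2 + D′ = D`, `a ≤ T`, `R ≥ 1` with `R + 3(D′+1) + b + a + (T−1)/2 ≤ s₀`, `R + 3(D′+1) + b + a + s₀ + (T−1)/2 + 2 ≤ N`, `(b/R)²e^{3b/R} ≤ 2`,
a junta mask `0 ≤ f ≤ G` and a direction `|v| ≤ 1` constant (`u₀`) on the edges outside `H` (arbitrary on the edges meeting `H`):
`|PM|·Σ_U W(U,M)·f(U∩H)·(Σ_p v_p x_p x_{πp})² ≤ B_v·C((T−1)/2, D′+1)·3^a·G·(4b+t+5T+4)²·(¼(b/R)²e^{3b/R})^{D′+1}`.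
Proof: 159a's averaged class split along `K = V(AA(H))`; per representative `A` the reduced object is brick J3's with the junta
`J ↦ f((A∩H) ∪ J)`, `α_h = v_h + v_{πh} − 2u₀`, `κ = u₀`, `L_A = Σ_{p∈full A} v_p + u₀(t−2f)` (`|L_A| ≤ t`); `Σ_{f,g} C(a,f)C(a−f,g) = 3^a`.
[cite: Rothvoss2017, §2 (PDF p. 6)] [cite: Agarwal2000DifferenceEquations, Remark 1.8.1 (1.8.8)] [cite: ChattamvelliShanmugam2020, §7.4] -/
theorem juntaHH_tilted_designValue_le {t T D : ℕ} {Bv : ℝ} {C : Finset ℕ} {w : ℕ → ℝ}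
    (hdes : IsExactDesign n t T D Bv C w) (M : PMatch n) {N : ℕ} (hn : (univ : Finset (Fin n)).card = 2 * N)
    (H : Finset (Fin n)) {a b : ℕ} (ha : (reps M.2.partner (vAA M.2.partner univ H)).card = a)
    (hb : (reps M.2.partner (vBH M.2.partner univ H ∪ vBN M.2.partner univ H)).card = b)
    {s₀ D' R : ℕ} (ht : t = 2 * s₀ + 1) (hD : a + 2 + D' = D) (haT : a ≤ T) (hR : 1 ≤ R)
    (hR1 : R + 3 * (D' + 1) + b + a + (T - 1) / 2 ≤ s₀) (hR2 : R + 3 * (D' + 1) + b + a + s₀ + (T - 1) / 2 + 2 ≤ N)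
    (hq : ((b : ℝ) / R) ^ 2 * Real.exp (3 * b / R) ≤ 2)
    (f : Finset (Fin n) → ℝ) {G : ℝ} (hG : ∀ I, |f I| ≤ G) (hf0 : ∀ I, 0 ≤ f I)
    (v : Fin n → ℝ) (hv : ∀ p, |v p| ≤ 1) (u₀ : ℝ) (hu₀ : |u₀| ≤ 1)
    (hv0 : ∀ p, p ∉ H → M.2.partner p ∉ H → v p = u₀) :
    (Fintype.card (PMatch n) : ℝ) * ∑ U : OddSet n, levelWeight n t C w U M *
        (f (U.1 ∩ H) *
          (∑ p : Fin n, v p * ((if p ∈ U.1 then (1 : ℝ) else 0) * (if M.2.partner p ∈ U.1 then (1 : ℝ) else 0))) ^ 2) ≤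
      Bv * ((((T - 1) / 2).choose (D' + 1) : ℕ) : ℝ) *
        ((3 : ℝ) ^ a * (G * (4 * (b : ℝ) + (t : ℝ) + 5 * T + 4) ^ 2 *
          ((1 / 4 : ℝ) * ((b : ℝ) / R) ^ 2 * Real.exp (3 * b / R)) ^ (D' + 1))) := by
  classical
  subst ht
  set π := M.2.partner with hπdef
  have hπ : ∀ v, π (π v) = v := partner_partner M
  have hπ' : ∀ v, π v ≠ v := partner_ne M
  obtain ⟨hS', hN', h0', hB'⟩ := sdiff_vAA_facts hπ hπ' hn H ha
  set S' := univ \ vAA π univ H with hS'def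
  have hb' : (reps π (vBH π S' H ∪ vBN π S' H)).card = b := by rw [hB', hb]
  have huniv : ∀ v ∈ (univ : Finset (Fin n)), π v ∈ univ := fun v _ => mem_univ _
  have hK : ∀ v ∈ vAA π univ H, π v ∈ vAA π univ H := vAA_stable hπ univ H huniv
  have hG0 : 0 ≤ G := (abs_nonneg _).trans (hG ∅)
  have hBv : 0 ≤ Bv := (sum_nonneg fun c _ => abs_nonneg (w c)).trans hdes.variation_le
  have hTt : T ≤ 2 * s₀ + 1 := hdes.2.2.1
  have haN : a ≤ N := by omega
  set q : ℝ := (1 / 4 : ℝ) * ((b : ℝ) / R) ^ 2 * Real.exp (3 * b / R) with hqdef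
  set Kc : ℝ := ((((T - 1) / 2).choose (D' + 1) : ℕ) : ℝ) with hKc
  -- the vertex tilt coefficients
  set α : Fin n → ℝ := fun h => v h + v (π h) - 2 * u₀ with hαdef
  have hα : ∀ h, |α h| ≤ 4 := fun h => by
    have h1 := abs_le.1 (hv h); have h2 := abs_le.1 (hv (π h)); have h3 := abs_le.1 hu₀
    rw [hαdef, abs_le]; constructor <;> linarith
  -- the constant of a class representative
  set LA : Finset (Fin n) → ℕ → ℝ := fun A f₁ => (∑ p ∈ full π A, v p) + u₀ * (((2 * s₀ + 1 : ℕ) : ℝ) - 2 * (f₁ : ℝ)) with hLAdef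
  have hLA : ∀ (A : Finset (Fin n)) (f g : ℕ), A ∈ shellIn π (vAA π univ H) (2 * f + g) g → f ≤ a →
      |LA A f| ≤ ((2 * s₀ + 1 : ℕ) : ℝ) := by
    intro A f g hA hfa
    obtain ⟨_, hAt, hAc⟩ := mem_shellIn.1 hA
    have hfull : (full π A).card = 2 * f := by have := card_full_add_card_half (π := π) A; omega
    have hf2 : 2 * (f : ℝ) ≤ ((2 * s₀ + 1 : ℕ) : ℝ) := by exact_mod_cast (show 2 * f ≤ 2 * s₀ + 1 by omega)
    have h1 : |∑ p ∈ full π A, v p| ≤ 2 * f := by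
      refine (abs_sum_le_sum_abs _ _).trans ?_
      calc ∑ p ∈ full π A, |v p| ≤ ∑ _p ∈ full π A, (1 : ℝ) := sum_le_sum fun p _ => hv p
        _ = 2 * f := by rw [sum_const, nsmul_eq_mul, mul_one, hfull]; push_cast; ring
    have h2 : |u₀ * (((2 * s₀ + 1 : ℕ) : ℝ) - 2 * (f : ℝ))| ≤ ((2 * s₀ + 1 : ℕ) : ℝ) - 2 * f := by
      rw [abs_mul, abs_of_nonneg (by linarith : (0:ℝ) ≤ ((2 * s₀ + 1 : ℕ) : ℝ) - 2 * (f : ℝ))]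
      exact mul_le_of_le_one_left (by linarith) hu₀
    rw [hLAdef]; exact (abs_add_le _ _).trans (by linarith)
  -- the cut function and its shell profile
  set F : Finset (Fin n) → ℝ := fun U => f (U ∩ H) *
    (∑ p' : Fin n, v p' * ((if p' ∈ U then (1 : ℝ) else 0) * (if π p' ∈ U then (1 : ℝ) else 0))) ^ 2 with hFdef
  set φ : ℕ → ℝ := fun c => (∑ U ∈ shellIn π univ (2 * s₀ + 1) c, F U) / ((shellIn π univ (2 * s₀ + 1) c).card : ℝ)
    with hφ
  -- the reduced object of a class representative `A`
  set ΦA : Finset (Fin n) → ℕ → ℕ → ℕ → ℝ := fun A f₁ g c =>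
    (∑ B ∈ shellIn π S' (2 * s₀ + 1 - (2 * f₁ + g)) (c - g),
        (fun J => f (A ∩ H ∪ J)) (B ∩ H) *
          ((∑ h ∈ B ∩ H, α h) - (∑ h ∈ S' ∩ H, α h * (if (h ∈ B ∧ π h ∉ B) then (1 : ℝ) else 0)) + LA A f₁ - u₀ * c) ^ 2) /
      ((shellIn π S' (2 * s₀ + 1 - (2 * f₁ + g)) (c - g)).card : ℝ) with hΦA
  set Φ : ℕ → ℕ → ℕ → ℝ := fun f₁ g c =>
    (∑ A ∈ shellIn π (vAA π univ H) (2 * f₁ + g) g, ΦA A f₁ g c) / ((shellIn π (vAA π univ H) (2 * f₁ + g) g).card : ℝ)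
    with hΦ
  set p : ℕ → ℕ → ℝ[X] := fun f₁ g => Polynomial.C (((a.choose f₁ : ℕ) : ℝ) * ((a - f₁).choose g : ℕ) /
      (N.descFactorial a : ℕ)) *
    (∏ i ∈ range f₁, (Polynomial.C ((((2 * s₀ + 1 : ℕ) : ℝ)) / 2 - i) - Polynomial.C (1 / 2 : ℝ) * X)) *
    (∏ i ∈ range g, (X - Polynomial.C (i : ℝ))) *
    (∏ i ∈ range (a - f₁ - g), (Polynomial.C ((N : ℝ) - (((2 * s₀ + 1 : ℕ) : ℝ)) / 2 - i) - Polynomial.C (1 / 2 : ℝ) * X))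
    with hp
  have hlev : ∀ c ∈ C, ∃ j : ℕ, c = 2 * j + 1 ∧ j ≤ (T - 1) / 2 ∧ j ≤ s₀ := by
    intro c hc
    obtain ⟨⟨j, hj⟩, _, hcT, _⟩ := hdes.2.2.2.1 c hc
    exact ⟨j, by omega, by omega, by omega⟩
  -- STEP A: the class decomposition on the levels
  have hsplit : ∀ c ∈ C, φ c = ∑ f₁ ∈ range (a + 1), ∑ g ∈ range (a - f₁ + 1), (p f₁ g).eval (c : ℝ) * Φ f₁ g c := by
    intro c hc
    obtain ⟨j, rfl, hjT, hjs⟩ := hlev c hc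
    have hsc : 2 * (s₀ - j) + (2 * j + 1) = 2 * s₀ + 1 := by omega
    have hsN : (s₀ - j) + (2 * j + 1) ≤ N := by omega
    rw [hφ]
    simp only
    rw [← hsc, shellAvg_eq_sum_classWeight_mul_avg₂ hπ hπ' huniv hn hK (subset_univ _) ha (s₀ - j) (2 * j + 1) hsN F]
    refine sum_congr rfl fun f' hf => sum_congr rfl fun g hg => ?_
    have hf' : f' ≤ a := Nat.lt_succ_iff.1 (mem_range.1 hf)
    rw [hp]
    simp only
    rw [classWeight_eval_level _ hsc hsN f' g (a - f' - g)]
    by_cases hfs : f' ≤ s₀ - j ∧ g ≤ 2 * j + 1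
    · have e1 : 2 * (s₀ - j - f') + (2 * j + 1 - g) = 2 * s₀ + 1 - (2 * f' + g) := by omega
      have hin : ∀ A ∈ shellIn π (vAA π univ H) (2 * f' + g) g,
          ∀ B ∈ shellIn π S' (2 * (s₀ - j - f') + (2 * j + 1 - g)) (2 * j + 1 - g),
          F (A ∪ B) = (fun J => f (A ∩ H ∪ J)) (B ∩ H) *
            ((∑ h ∈ B ∩ H, α h) - (∑ h ∈ S' ∩ H, α h * (if (h ∈ B ∧ π h ∉ B) then (1 : ℝ) else 0)) + LA A f' -
              u₀ * ((2 * j + 1 : ℕ) : ℝ)) ^ 2 := by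
        intro A hA B hB
        obtain ⟨hAK, hAt, hAc⟩ := mem_shellIn.1 hA
        obtain ⟨hBS, hBt, hBc⟩ := mem_shellIn.1 hB
        obtain ⟨c1, c2⟩ := containment_union_pattern_J hπ v u₀ hv0 hAK hBS
        rw [hFdef]
        simp only
        rw [c1, c2]
        congr 1
        have hBfull : (B.card : ℝ) - ((half π B).card : ℝ) = 2 * (s₀ : ℝ) - 2 * f' - 2 * j := by
          rw [hBt, hBc, Nat.cast_add, Nat.cast_mul, Nat.cast_sub (by omega : f' ≤ s₀ - j), Nat.cast_sub hjs,
            Nat.cast_sub (by omega : g ≤ 2 * j + 1)]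
          push_cast; ring
        rw [hBfull, hLAdef, hαdef, hS'def]
        simp only
        push_cast
        ring
      rw [hΦ]
      simp only
      rw [hΦA]
      simp only
      rw [← e1]
      have hinner : ∀ A ∈ shellIn π (vAA π univ H) (2 * f' + g) g,
          ∑ B ∈ shellIn π S' (2 * (s₀ - j - f') + (2 * j + 1 - g)) (2 * j + 1 - g), F (A ∪ B) =
          ∑ B ∈ shellIn π S' (2 * (s₀ - j - f') + (2 * j + 1 - g)) (2 * j + 1 - g),
            (fun J => f (A ∩ H ∪ J)) (B ∩ H) *
            ((∑ h ∈ B ∩ H, α h) - (∑ h ∈ S' ∩ H, α h * (if (h ∈ B ∧ π h ∉ B) then (1 : ℝ) else 0)) + LA A f' -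
              u₀ * ((2 * j + 1 : ℕ) : ℝ)) ^ 2 := fun A hA => sum_congr rfl (hin A hA)
      rw [sum_congr rfl hinner, ← sum_div, div_div]
      ring
    · have hz : ((s₀ - j).descFactorial f' : ℝ) * ((2 * j + 1).descFactorial g : ℕ) = 0 := by
        rcases not_and_or.1 hfs with h1 | h1
        · rw [Nat.descFactorial_eq_zero_iff_lt.2 (by omega), Nat.cast_zero, zero_mul]
        · rw [Nat.descFactorial_eq_zero_iff_lt.2 (by omega : 2 * j + 1 < g), Nat.cast_zero, mul_zero]
      have e1 : (((a.choose f' : ℕ) : ℝ) * ((a - f').choose g : ℕ) * ((s₀ - j).descFactorial f' : ℕ) *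
          ((2 * j + 1).descFactorial g : ℕ) * ((N - (s₀ - j) - (2 * j + 1)).descFactorial (a - f' - g) : ℕ) /
          (N.descFactorial a : ℕ)) = 0 := by
        rw [show (((a.choose f' : ℕ) : ℝ) * ((a - f').choose g : ℕ) * ((s₀ - j).descFactorial f' : ℕ) *
          ((2 * j + 1).descFactorial g : ℕ)) = ((a.choose f' : ℕ) : ℝ) * ((a - f').choose g : ℕ) *
          ((((s₀ - j).descFactorial f' : ℕ) : ℝ) * ((2 * j + 1).descFactorial g : ℕ)) by ring, hz]
        simp
      have e2 : ((a.choose f' : ℕ) : ℝ) * ((a - f').choose g : ℕ) / (N.descFactorial a : ℕ) *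
          ((s₀ - j).descFactorial f' : ℕ) * ((2 * j + 1).descFactorial g : ℕ) *
          ((N - (s₀ - j) - (2 * j + 1)).descFactorial (a - f' - g) : ℕ) = 0 := by
        rw [show ((a.choose f' : ℕ) : ℝ) * ((a - f').choose g : ℕ) / (N.descFactorial a : ℕ) *
          ((s₀ - j).descFactorial f' : ℕ) * ((2 * j + 1).descFactorial g : ℕ) =
          ((a.choose f' : ℕ) : ℝ) * ((a - f').choose g : ℕ) / (N.descFactorial a : ℕ) *
          ((((s₀ - j).descFactorial f' : ℕ) : ℝ) * ((2 * j + 1).descFactorial g : ℕ)) by ring, hz]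
        simp
      rw [e1, e2, zero_mul, zero_mul]
  -- STEP B: each class representative is priced by brick J3; the class value is their average
  have hclass : ∀ f' ∈ range (a + 1), ∀ g ∈ range (a - f' + 1),
      ∑ c ∈ C, w c * ((p f' g).eval (c : ℝ) * Φ f' g c) ≤
        Bv * (((a.choose f' : ℕ) : ℝ) * ((a - f').choose g : ℕ)) * Kc *
          (G * (4 * (b : ℝ) + ((2 * s₀ + 1 : ℕ) : ℝ) + 5 * T + 4) ^ 2 * q ^ (D' + 1)) := by
    intro f' hf g hg
    have hf' : f' ≤ a := Nat.lt_succ_iff.1 (mem_range.1 hf)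
    have hg' : g ≤ a - f' := Nat.lt_succ_iff.1 (mem_range.1 hg)
    have hfge : f' + g + (a - f' - g) = a := by omega
    have hgdm := Nat.div_add_mod g 2
    have hgm : g % 2 < 2 := Nat.mod_lt _ (by norm_num)
    have ht' : 2 * (s₀ - f' - g / 2) + (1 - g % 2) = 2 * s₀ + 1 - (2 * f' + g) := by omega
    have hdeg : (p f' g).natDegree + 2 + D' ≤ D := by
      have h := natDegree_classWeight_le (((a.choose f' : ℕ) : ℝ) * ((a - f').choose g : ℕ) / (N.descFactorial a : ℕ))
        ((((2 * s₀ + 1 : ℕ) : ℝ)) / 2) ((N : ℝ) - (((2 * s₀ + 1 : ℕ) : ℝ)) / 2) f' g (a - f' - g)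
      simp only [hp]; omega
    have hP : ∀ c ∈ C, |(p f' g).eval (c : ℝ)| ≤ ((a.choose f' : ℕ) : ℝ) * ((a - f').choose g : ℕ) := by
      intro c hc
      obtain ⟨j, rfl, hjT, hjs⟩ := hlev c hc
      have hsc : 2 * (s₀ - j) + (2 * j + 1) = 2 * s₀ + 1 := by omega
      have hsN : (s₀ - j) + (2 * j + 1) ≤ N := by omega
      obtain ⟨h1, h2⟩ := classWeight_eval_level_le (t := 2 * s₀ + 1) hsc hsN hfge haN
      rw [hp]
      simp only
      rw [abs_of_nonneg h1]
      exact h2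
    have hpC : ∀ c ∈ C, c < g → (p f' g).eval (c : ℝ) = 0 := by
      intro c hc hlt
      rw [hp]
      exact classWeight_eval_eq_zero_of_lt _ _ _ f' g (a - f' - g) hlt
    have hpg : g ≠ 0 → (p f' g).eval 0 = 0 := by
      intro hg0
      have h := classWeight_eval_eq_zero_of_lt (((a.choose f' : ℕ) : ℝ) * ((a - f').choose g : ℕ) / (N.descFactorial a : ℕ))
        ((((2 * s₀ + 1 : ℕ) : ℝ)) / 2) ((N : ℝ) - (((2 * s₀ + 1 : ℕ) : ℝ)) / 2) f' g (a - f' - g) (c := 0) (by omega)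
      rw [hp]; simpa using h
    have hp0 : 0 ≤ (p f' g).eval 0 := by
      rcases Nat.eq_zero_or_pos g with hg0 | hgpos
      · subst hg0
        rw [hp]
        simp only
        exact classWeight_eval_zero_nonneg (by positivity) (by omega) (by omega)
      · exact (hpg (by omega)).symm.le
    have hrep : ∀ A ∈ shellIn π (vAA π univ H) (2 * f' + g) g,
        ∑ c ∈ C, w c * ((p f' g).eval (c : ℝ) * ΦA A f' g c) ≤
          Bv * (((a.choose f' : ℕ) : ℝ) * ((a - f').choose g : ℕ)) * Kc *
            (G * (4 * (b : ℝ) + ((2 * s₀ + 1 : ℕ) : ℝ) + 5 * T + 4) ^ 2 * q ^ (D' + 1)) := by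
      intro A hA
      have hJ := tiltedJunta_levelSum_le hπ hπ' hdes hS' hN' H h0' hb' (s₀ := s₀ - f' - g / 2)
        (c₀ := 1 - g % 2) (i₀ := g / 2) (g := g) (D' := D') (R := R) (by omega) (by omega) (by omega) hR
        (by omega) (by omega) hq (fun J => f (A ∩ H ∪ J)) (fun J => hG _) (fun J => hf0 _) α hα u₀ (LA A f') hu₀
        (hLA A f' g hA hf') (p f' g) hdeg hp0 hpg hpC hP
      rw [ht', ← hqdef, ← hKc] at hJ
      rw [hΦA]
      exact hJ
    have hswap : ∑ c ∈ C, w c * ((p f' g).eval (c : ℝ) * Φ f' g c) =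
        (∑ A ∈ shellIn π (vAA π univ H) (2 * f' + g) g, ∑ c ∈ C, w c * ((p f' g).eval (c : ℝ) * ΦA A f' g c)) /
          ((shellIn π (vAA π univ H) (2 * f' + g) g).card : ℝ) := by
      rw [hΦ]
      simp only
      rw [sum_comm, sum_div]
      refine sum_congr rfl fun c _ => ?_
      rw [sum_div, sum_div, mul_sum, mul_sum]
      exact sum_congr rfl fun A _ => by ring
    rw [hswap]
    exact sum_div_card_le_of_le' _ _ (by positivity) hrep
  -- STEP C
  have hPM : (Fintype.card (PMatch n) : ℝ) ≠ 0 :=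
    Nat.cast_ne_zero.2 (Fintype.card_pos_iff.2 ⟨M⟩).ne'
  rw [designValue_eq_shellAvg (2 * s₀ + 1) hdes.1 C w M F, ← mul_assoc, mul_inv_cancel₀ hPM, one_mul]
  simp only [← shellIn_univ]
  calc ∑ c ∈ C, w c * φ c
      = ∑ c ∈ C, ∑ f' ∈ range (a + 1), ∑ g ∈ range (a - f' + 1), w c * ((p f' g).eval (c : ℝ) * Φ f' g c) := by
        refine sum_congr rfl fun c hc => ?_
        rw [hsplit c hc, mul_sum]
        refine sum_congr rfl fun f' _ => ?_
        rw [mul_sum]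
    _ = ∑ f' ∈ range (a + 1), ∑ g ∈ range (a - f' + 1), ∑ c ∈ C, w c * ((p f' g).eval (c : ℝ) * Φ f' g c) := by
        rw [sum_comm]
        refine sum_congr rfl fun f' _ => ?_
        rw [sum_comm]
    _ ≤ ∑ f' ∈ range (a + 1), ∑ g ∈ range (a - f' + 1),
          Bv * (((a.choose f' : ℕ) : ℝ) * ((a - f').choose g : ℕ)) * Kc *
            (G * (4 * (b : ℝ) + ((2 * s₀ + 1 : ℕ) : ℝ) + 5 * T + 4) ^ 2 * q ^ (D' + 1)) :=
        sum_le_sum fun f' hf => sum_le_sum fun g hg => hclass f' hf g hg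
    _ = Bv * Kc * ((∑ f' ∈ range (a + 1), ∑ g ∈ range (a - f' + 1), ((a.choose f' : ℕ) : ℝ) * ((a - f').choose g : ℕ)) *
          (G * (4 * (b : ℝ) + ((2 * s₀ + 1 : ℕ) : ℝ) + 5 * T + 4) ^ 2 * q ^ (D' + 1))) := by
        rw [sum_mul, mul_sum]
        refine sum_congr rfl fun f' _ => ?_
        rw [sum_mul, mul_sum]
        refine sum_congr rfl fun g _ => ?_
        ring
    _ = _ := by rw [sum_choose_mul_choose_eq_three_pow, hKc]

end Main

end Summit.PneNP.PneNP.Theorems.ChebyshevTracialDesignTiltedJuntaClasses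

end
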